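import Mathlib
import Literature.Analysis.FluidPDE.SuitableWeak
import Literature.Analysis.FluidPDE.LocalEnergyTimeShift
import Literature.Analysis.FluidPDE.NSSuitableESSProofs
import Literature.Analysis.FluidPDE.WeakSpatialGradientSum
import Literature.Analysis.FluidPDE.LerayHopfProofs
import HarnessLib

/-!
# Tools for the TIME-PERIODIC stratum of the crux `EulerZoomLiouville.PowerGaugeEulerLiouville`
# (route №10 `EulerZoomLiouville`, item stmt-NavierStokesRegularity-19832) — period boxes under the `E`-gauge

Helper file (theorems only; `--supports stmt-NavierStokesRegularity-19832`, line `birth`, a stratum of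
STUB 3 `stub_noCollapseFromZero`). Seat ns-typeII-p3 (cell ns-regularity-ideate §B, D-0081).  The stratum
itself («a TIME-PERIODIC member of Seregin's power-gauged ancient Euler class vanishes, every `ρ > 0`»)
is assembled in the sequel `EulerZoomLiouvillePowerGaugeEulerLiouvilleTimePeriodic.lean`; this file holds
the measure-theoretic bookkeeping, which uses only the ARITHMETIC of the `E`-weight
`a^{ρ} E(a) ≤ c` (`E(a) = a⁻¹ ∫∫_{Q_a(0)} |H|²_F`, tree `cknE`) — no Euler system, no pressure, no local
energy inequality:
* `weakGradient_ae_shift_of_periodic` — if `u(τ − P, ·) = u(τ, ·)` for all `τ < 0` and `H` is a weak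
  spatial gradient of `u` on the slab `(−∞,0) × ℝ³`, then `H(τ − P, y) = H(τ, y)` a.e. on the slab
  (time translation preserves weak gradients on slabs, `HasWeakSpatialGradientOn.timeShift`, and weak
  gradients are a.e. unique, `HasWeakSpatialGradientOn.ae_eq`);
* `setLIntegral_box_shift`, `setLIntegral_periodBox_eq` — hence every period box
  `(−(k+1)P, −kP) × K` carries the same enstrophy mass `J = ∫_{(−P,0)×K} |H|²_F`;
* `mul_periodBox_le` — `n` disjoint period boxes fit in the window `(−nP, 0) × K`: `n · J ≤ ∫_{(−nP,0)×K}|H|²_F`;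
* `setLIntegral_window_le_of_gaugeE` — the gauge gives `∫_{(−T,0)×B_R}|H|²_F ≤ c · a^{1−ρ}` whenever
  `R ≤ a`, `T ≤ a²`;
* `setLIntegral_periodBox_eq_zero` — with `a = n ≥ max(R, P)`: `J ≤ c · n^{−ρ} → 0`, so `J = 0` (`ρ > 0`).
WHAT THIS IS NOT: not NS; nothing here bears on regularity or blow-up; the crux is OPEN on `0 < ρ ≤ 1/2`.
[folklore]
-/

noncomputable section

-- the summit and its single problem share the name `NavierStokesRegularity` (D-0017 nested layout)
set_option linter.dupNamespace false

open Set Function Filter Topology MeasureTheory Metric TopologicalSpace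
open scoped NNReal ENNReal InnerProductSpace RealInnerProductSpace

namespace Summit.NavierStokesRegularity.NavierStokesRegularity.Theorems.PowerGaugeEulerLiouville.TimePeriodic

open Literature.Analysis Literature.Analysis.FluidPDE

/-! ## (1) Weak gradients of time-periodic fields are a.e. periodic on the slab -/

/-- **A.e. periodicity of the weak gradient.**  If `u(τ − P, ·) = u(τ, ·)` for all `τ < 0` (`P ≥ 0`)
and `H` is a weak spatial gradient of `u` on the slab `(−∞, 0) × ℝ³`, then `H(τ − P, y) = H(τ, y)`
for a.e. `(τ, y)` in the slab (the translate `H(· − P, ·)` is again a weak gradient of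
`u(· − P, ·) = u` on every finite slab `(−M, 0) × ℝ³`, and weak gradients are a.e. unique). [folklore] -/
theorem weakGradient_ae_shift_of_periodic
    {u : ℝ → EuclideanSpace ℝ (Fin 3) → EuclideanSpace ℝ (Fin 3)}
    {H : ℝ → EuclideanSpace ℝ (Fin 3) → EuclideanSpace ℝ (Fin 3) →L[ℝ] EuclideanSpace ℝ (Fin 3)}
    (hH : HasWeakSpatialGradientOn (slab (EuclideanSpace ℝ (Fin 3)) (Iio 0) isOpen_Iio) u H)
    {P : ℝ} (hP : 0 ≤ P) (hu : ∀ τ : ℝ, τ < 0 → u (τ - P) = u τ) :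
    ∀ᵐ z ∂(volume.restrict (Iio (0 : ℝ) ×ˢ (univ : Set (EuclideanSpace ℝ (Fin 3))))),
      H (z.1 - P) z.2 = H z.1 z.2 := by
  -- on each finite slab `(-M, 0) × ℝ³`
  have hM : ∀ M : ℕ, ∀ᵐ z ∂(volume.restrict
      (Ioo (-(M : ℝ)) 0 ×ˢ (univ : Set (EuclideanSpace ℝ (Fin 3))))), H (z.1 - P) z.2 = H z.1 z.2 := by
    intro M
    have h1 : HasWeakSpatialGradientOn
        (slab (EuclideanSpace ℝ (Fin 3)) (Ioo (-(M : ℝ) - P) 0) isOpen_Ioo) u H :=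
      hH.mono (slab_mono Ioo_subset_Iio_self)
    have h2 := h1.timeShift (-P)
    have h3 : HasWeakSpatialGradientOn (slab (EuclideanSpace ℝ (Fin 3)) (Ioo (-(M : ℝ)) 0) isOpen_Ioo)
        (fun s y => u (-P + s) y) (fun s y => H (-P + s) y) :=
      h2.mono (slab_mono (Ioo_subset_Ioo (by linarith) (by linarith)))
    have h4 : HasWeakSpatialGradientOn (slab (EuclideanSpace ℝ (Fin 3)) (Ioo (-(M : ℝ)) 0) isOpen_Ioo)
        u (fun s y => H (-P + s) y) := by
      refine h3.congr_eqOn ?_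
      intro z hz
      have hz' : z.1 < 0 := (mem_Ioo.1 (mem_slab.1 hz)).2
      show u z.1 z.2 = u (-P + z.1) z.2
      rw [neg_add_eq_sub, hu z.1 hz']
    have h5 : HasWeakSpatialGradientOn (slab (EuclideanSpace ℝ (Fin 3)) (Ioo (-(M : ℝ)) 0) isOpen_Ioo)
        u H :=
      hH.mono (slab_mono Ioo_subset_Iio_self)
    have h6 := h4.ae_eq h5
    rw [coe_slab] at h6
    filter_upwards [h6] with z hz
    have hz' : H (-P + z.1) z.2 = H z.1 z.2 := hz
    rwa [neg_add_eq_sub] at hz'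
  -- exhaust the slab
  have hU : (Iio (0 : ℝ) ×ˢ (univ : Set (EuclideanSpace ℝ (Fin 3)))) =
      ⋃ M : ℕ, (Ioo (-(M : ℝ)) 0 ×ˢ (univ : Set (EuclideanSpace ℝ (Fin 3)))) := by
    ext z
    simp only [mem_prod, mem_Iio, mem_univ, and_true, mem_iUnion, mem_Ioo]
    constructor
    · intro hz
      obtain ⟨M, hM⟩ := exists_nat_gt (-z.1)
      exact ⟨M, by linarith, hz⟩
    · rintro ⟨M, -, h2⟩
      exact h2
  rw [hU, ae_restrict_iUnion_iff]
  exact hM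

/-! ## (2) The enstrophy mass is the same on every period box -/

/-- **Shifting a box by one period inside the slab does not change the enstrophy mass**: for
`t₂ ≤ 0`, `∫_{(t₁−P, t₂−P) × K} |H|²_F = ∫_{(t₁, t₂) × K} |H|²_F` (translate, then use the a.e.
periodicity of `H` on the box `(t₁, t₂) × K ⊆` slab). [folklore] -/
theorem setLIntegral_box_shift
    {H : ℝ → EuclideanSpace ℝ (Fin 3) → EuclideanSpace ℝ (Fin 3) →L[ℝ] EuclideanSpace ℝ (Fin 3)}
    {P : ℝ}
    (hper : ∀ᵐ z ∂(volume.restrict (Iio (0 : ℝ) ×ˢ (univ : Set (EuclideanSpace ℝ (Fin 3))))),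
      H (z.1 - P) z.2 = H z.1 z.2)
    {t₁ t₂ : ℝ} (ht₂ : t₂ ≤ 0) {K : Set (EuclideanSpace ℝ (Fin 3))} (hK : MeasurableSet K) :
    ∫⁻ z in Ioo (t₁ - P) (t₂ - P) ×ˢ K, ENNReal.ofReal (frobeniusNormSq (H z.1 z.2)) =
      ∫⁻ z in Ioo t₁ t₂ ×ˢ K, ENNReal.ofReal (frobeniusNormSq (H z.1 z.2)) := by
  have h := setLIntegral_prod_timeShift (-P) (t₁ - P) (t₂ - P) K
    (fun z : ℝ × EuclideanSpace ℝ (Fin 3) => ENNReal.ofReal (frobeniusNormSq (H z.1 z.2)))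
  rw [show t₁ - P - -P = t₁ by ring, show t₂ - P - -P = t₂ by ring] at h
  rw [← h]
  refine setLIntegral_congr_fun_ae (measurableSet_Ioo.prod hK) ?_
  have hsub : Ioo t₁ t₂ ×ˢ K ⊆ Iio (0 : ℝ) ×ˢ (univ : Set (EuclideanSpace ℝ (Fin 3))) :=
    prod_mono (fun τ hτ => lt_of_lt_of_le hτ.2 ht₂) (subset_univ _)
  filter_upwards [ae_imp_of_ae_restrict (ae_restrict_of_ae_restrict_of_subset hsub hper)]
    with z hz hzmem
  show ENNReal.ofReal (frobeniusNormSq (H (-P + z.1) z.2)) = ENNReal.ofReal (frobeniusNormSq (H z.1 z.2))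
  rw [neg_add_eq_sub, hz hzmem]

/-- **Every period box carries the same enstrophy mass**:
`∫_{(−(k+1)P, −kP) × K} |H|²_F = ∫_{(−P, 0) × K} |H|²_F` for all `k ∈ ℕ` (`P ≥ 0`). [folklore] -/
theorem setLIntegral_periodBox_eq
    {H : ℝ → EuclideanSpace ℝ (Fin 3) → EuclideanSpace ℝ (Fin 3) →L[ℝ] EuclideanSpace ℝ (Fin 3)}
    {P : ℝ} (hP : 0 ≤ P)
    (hper : ∀ᵐ z ∂(volume.restrict (Iio (0 : ℝ) ×ˢ (univ : Set (EuclideanSpace ℝ (Fin 3))))),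
      H (z.1 - P) z.2 = H z.1 z.2)
    {K : Set (EuclideanSpace ℝ (Fin 3))} (hK : MeasurableSet K) (k : ℕ) :
    ∫⁻ z in Ioo (-(((k : ℝ) + 1) * P)) (-((k : ℝ) * P)) ×ˢ K,
        ENNReal.ofReal (frobeniusNormSq (H z.1 z.2)) =
      ∫⁻ z in Ioo (-P) 0 ×ˢ K, ENNReal.ofReal (frobeniusNormSq (H z.1 z.2)) := by
  induction k with
  | zero => simp
  | succ k ih =>
    have ht₂ : -((k : ℝ) * P) ≤ 0 := by
      have : 0 ≤ (k : ℝ) * P := by positivity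
      linarith
    have h := setLIntegral_box_shift hper (t₁ := -(((k : ℝ) + 1) * P)) ht₂ hK
    rw [← ih, ← h]
    congr 2
    · push_cast; ring

/-! ## (3) Packing `n` period boxes into the window `(−nP, 0)` -/

/-- **`n` disjoint period boxes fit in the window `(−nP, 0) × K`**:
`n · ∫_{(−P,0)×K} |H|²_F ≤ ∫_{(−nP, 0)×K} |H|²_F`. [folklore] -/
theorem mul_periodBox_le
    {H : ℝ → EuclideanSpace ℝ (Fin 3) → EuclideanSpace ℝ (Fin 3) →L[ℝ] EuclideanSpace ℝ (Fin 3)}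
    {P : ℝ} (hP : 0 ≤ P)
    (hper : ∀ᵐ z ∂(volume.restrict (Iio (0 : ℝ) ×ˢ (univ : Set (EuclideanSpace ℝ (Fin 3))))),
      H (z.1 - P) z.2 = H z.1 z.2)
    {K : Set (EuclideanSpace ℝ (Fin 3))} (hK : MeasurableSet K) (n : ℕ) :
    (n : ℝ≥0∞) * ∫⁻ z in Ioo (-P) 0 ×ˢ K, ENNReal.ofReal (frobeniusNormSq (H z.1 z.2)) ≤
      ∫⁻ z in Ioo (-((n : ℝ) * P)) 0 ×ˢ K, ENNReal.ofReal (frobeniusNormSq (H z.1 z.2)) := by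
  induction n with
  | zero => simp
  | succ n ih =>
    set f : ℝ × EuclideanSpace ℝ (Fin 3) → ℝ≥0∞ :=
      fun z => ENNReal.ofReal (frobeniusNormSq (H z.1 z.2)) with hf
    -- the new box `(−(n+1)P, −nP) × K` and the old window `(−nP, 0) × K` are disjoint and both lie
    -- in the new window `(−(n+1)P, 0) × K`
    have hdisj : Disjoint (Ioo (-(((n : ℝ) + 1) * P)) (-((n : ℝ) * P)) ×ˢ K)
        (Ioo (-((n : ℝ) * P)) 0 ×ˢ K) := by
      refine Disjoint.set_prod_left ?_ _ _
      exact disjoint_left.2 fun τ h1 h2 => lt_irrefl _ (h1.2.trans h2.1)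
    have hsub : Ioo (-(((n : ℝ) + 1) * P)) (-((n : ℝ) * P)) ×ˢ K ∪ Ioo (-((n : ℝ) * P)) 0 ×ˢ K ⊆
        Ioo (-((((n + 1 : ℕ) : ℝ)) * P)) 0 ×ˢ K := by
      rw [← union_prod]
      refine prod_mono ?_ Subset.rfl
      have h0 : 0 ≤ (n : ℝ) * P := by positivity
      intro τ hτ
      rcases hτ with h | h
      · exact ⟨by push_cast; exact h.1, by linarith [h.2]⟩
      · exact ⟨by push_cast; linarith [h.1], h.2⟩
    calc (((n + 1 : ℕ) : ℝ≥0∞)) * ∫⁻ z in Ioo (-P) 0 ×ˢ K, f z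
        = (n : ℝ≥0∞) * (∫⁻ z in Ioo (-P) 0 ×ˢ K, f z) + ∫⁻ z in Ioo (-P) 0 ×ˢ K, f z := by
          push_cast; ring
      _ ≤ (∫⁻ z in Ioo (-((n : ℝ) * P)) 0 ×ˢ K, f z) +
            ∫⁻ z in Ioo (-(((n : ℝ) + 1) * P)) (-((n : ℝ) * P)) ×ˢ K, f z := by
          rw [setLIntegral_periodBox_eq hP hper hK n]
          exact add_le_add ih le_rfl
      _ = ∫⁻ z in Ioo (-(((n : ℝ) + 1) * P)) (-((n : ℝ) * P)) ×ˢ K ∪ Ioo (-((n : ℝ) * P)) 0 ×ˢ K, f z := by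
          rw [add_comm, lintegral_union (measurableSet_Ioo.prod hK) hdisj]
      _ ≤ ∫⁻ z in Ioo (-((((n + 1 : ℕ) : ℝ)) * P)) 0 ×ˢ K, f z := lintegral_mono_set hsub

/-! ## (4) The `E`-gauge bound on the window and the vanishing of the period mass -/

/-- **The gauged `E`-bound on a window**: if `a^ρ E(H; Q_a(0)) ≤ c` and `(−T, 0) × B_R ⊆ Q_a(0)`
(`R ≤ a`, `T ≤ a²`), then `∫_{(−T,0)×B_R} |H|²_F ≤ c · a^{1−ρ}`. [folklore] -/
theorem setLIntegral_window_le_of_gaugeE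
    {H : ℝ → EuclideanSpace ℝ (Fin 3) → EuclideanSpace ℝ (Fin 3) →L[ℝ] EuclideanSpace ℝ (Fin 3)}
    {ρ : ℝ} {c : ℝ≥0} {a T R : ℝ} (ha : 0 < a) (hR : R ≤ a) (hT : T ≤ a ^ 2)
    (hE : ENNReal.ofReal (a ^ ρ) * cknE a (0 : ℝ × EuclideanSpace ℝ (Fin 3)) H ≤ (c : ℝ≥0∞)) :
    ∫⁻ z in Ioo (-T) 0 ×ˢ ball (0 : EuclideanSpace ℝ (Fin 3)) R,
        ENNReal.ofReal (frobeniusNormSq (H z.1 z.2)) ≤ ENNReal.ofReal ((c : ℝ) * a ^ (1 - ρ)) := by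
  set I : ℝ≥0∞ := ∫⁻ z in parabolicCylinder a (0 : ℝ × EuclideanSpace ℝ (Fin 3)),
    ENNReal.ofReal (frobeniusNormSq (H z.1 z.2)) with hI
  have hsub : Ioo (-T) 0 ×ˢ ball (0 : EuclideanSpace ℝ (Fin 3)) R ⊆
      parabolicCylinder a (0 : ℝ × EuclideanSpace ℝ (Fin 3)) := by
    unfold parabolicCylinder
    exact prod_mono (Ioo_subset_Ioo (by simp; linarith) le_rfl) (ball_subset_ball hR)
  refine (lintegral_mono_set hsub).trans ?_
  -- `a^ρ · a⁻¹ · I ≤ c`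
  have h1 : ENNReal.ofReal (a ^ ρ) * ((ENNReal.ofReal a)⁻¹ * I) ≤ (c : ℝ≥0∞) := hE
  have h2 : ENNReal.ofReal (a ^ ρ) * (ENNReal.ofReal a)⁻¹ = ENNReal.ofReal (a ^ (ρ - 1)) := by
    rw [← ENNReal.ofReal_inv_of_pos ha, ← ENNReal.ofReal_mul (Real.rpow_nonneg ha.le _)]
    congr 1
    rw [Real.rpow_sub ha, Real.rpow_one, div_eq_mul_inv]
  rw [← mul_assoc, h2] at h1
  have hpos : 0 < a ^ (ρ - 1) := Real.rpow_pos_of_pos ha _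
  have h3 : I ≤ (c : ℝ≥0∞) / ENNReal.ofReal (a ^ (ρ - 1)) := by
    rw [ENNReal.le_div_iff_mul_le (Or.inl (ENNReal.ofReal_pos.2 hpos).ne') (Or.inl ENNReal.ofReal_ne_top),
      mul_comm]
    exact h1
  refine h3.trans (le_of_eq ?_)
  rw [← ENNReal.ofReal_coe_nnreal, ← ENNReal.ofReal_div_of_pos hpos]
  congr 1
  rw [div_eq_mul_inv, ← Real.rpow_neg ha.le, neg_sub]

/-- **The period mass vanishes.**  If `H` is a.e. `P`-periodic on the slab (`P > 0`) and
`a^ρ E(H; Q_a(0)) ≤ c` for all `a > 0` with `ρ > 0`, then `∫_{(−P,0)×B_R} |H|²_F = 0` for every `R`: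
`n · J ≤ c · n^{1−ρ}` with the radius `a = n ≥ max(R, P)`, i.e. `J ≤ c · n^{−ρ} → 0`. [folklore] -/
theorem setLIntegral_periodBox_eq_zero
    {H : ℝ → EuclideanSpace ℝ (Fin 3) → EuclideanSpace ℝ (Fin 3) →L[ℝ] EuclideanSpace ℝ (Fin 3)}
    {P : ℝ} (hP : 0 < P)
    (hper : ∀ᵐ z ∂(volume.restrict (Iio (0 : ℝ) ×ˢ (univ : Set (EuclideanSpace ℝ (Fin 3))))),
      H (z.1 - P) z.2 = H z.1 z.2)
    {ρ : ℝ} (hρ : 0 < ρ) {c : ℝ≥0}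
    (hE : ∀ a : ℝ, 0 < a →
      ENNReal.ofReal (a ^ ρ) * cknE a (0 : ℝ × EuclideanSpace ℝ (Fin 3)) H ≤ (c : ℝ≥0∞)) (R : ℝ) :
    ∫⁻ z in Ioo (-P) 0 ×ˢ ball (0 : EuclideanSpace ℝ (Fin 3)) R,
        ENNReal.ofReal (frobeniusNormSq (H z.1 z.2)) = 0 := by
  set J : ℝ≥0∞ := ∫⁻ z in Ioo (-P) 0 ×ˢ ball (0 : EuclideanSpace ℝ (Fin 3)) R,
    ENNReal.ofReal (frobeniusNormSq (H z.1 z.2)) with hJ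
  -- for `n ≥ max(R, P)`, `n ≥ 1`: `J ≤ c · n^{−ρ}`
  have key : ∀ᶠ n : ℕ in atTop, J ≤ ENNReal.ofReal ((c : ℝ) * (n : ℝ) ^ (-ρ)) := by
    have hev : ∀ᶠ n : ℕ in atTop, max (max R P) 1 ≤ (n : ℝ) :=
      tendsto_natCast_atTop_atTop.eventually_ge_atTop _
    filter_upwards [hev] with n hn
    have hn1 : (1 : ℝ) ≤ n := le_trans (le_max_right _ _) hn
    have hnR : R ≤ n := le_trans ((le_max_left _ _).trans (le_max_left _ _)) hn
    have hnP : P ≤ n := le_trans ((le_max_right _ _).trans (le_max_left _ _)) hn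
    have hn0 : (0 : ℝ) < n := by linarith
    have hT : (n : ℝ) * P ≤ (n : ℝ) ^ 2 := by nlinarith
    have h1 := mul_periodBox_le hP.le hper (measurableSet_ball (x := (0 : EuclideanSpace ℝ (Fin 3)))
      (ε := R)) n
    have h2 := setLIntegral_window_le_of_gaugeE (H := H) hn0 hnR hT (hE n hn0)
    have h3 : (n : ℝ≥0∞) * J ≤ ENNReal.ofReal ((c : ℝ) * (n : ℝ) ^ (1 - ρ)) := h1.trans h2
    -- divide by `n`
    have hn0' : (n : ℝ≥0∞) ≠ 0 := by exact_mod_cast (show (n : ℕ) ≠ 0 by exact_mod_cast hn0.ne')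
    have h4 : J ≤ ENNReal.ofReal ((c : ℝ) * (n : ℝ) ^ (1 - ρ)) / (n : ℝ≥0∞) := by
      rw [ENNReal.le_div_iff_mul_le (Or.inl hn0') (Or.inl (ENNReal.natCast_ne_top n)), mul_comm]
      exact h3
    refine h4.trans (le_of_eq ?_)
    rw [← ENNReal.ofReal_natCast, ← ENNReal.ofReal_div_of_pos hn0]
    congr 1
    rw [Real.rpow_sub hn0, Real.rpow_one, Real.rpow_neg hn0.le]
    field_simp
  -- the right-hand side tends to `0`
  have hlim : Tendsto (fun n : ℕ => ENNReal.ofReal ((c : ℝ) * (n : ℝ) ^ (-ρ))) atTop (𝓝 0) := by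
    have h1 : Tendsto (fun n : ℕ => ((n : ℝ)) ^ (-ρ)) atTop (𝓝 0) :=
      (tendsto_rpow_neg_atTop hρ).comp tendsto_natCast_atTop_atTop
    have h2 := h1.const_mul (c : ℝ)
    rw [mul_zero] at h2
    have h3 := ENNReal.tendsto_ofReal h2
    rwa [ENNReal.ofReal_zero] at h3
  exact le_antisymm (le_of_tendsto_of_tendsto tendsto_const_nhds hlim key) bot_le


end Summit.NavierStokesRegularity.NavierStokesRegularity.Theorems.PowerGaugeEulerLiouville.TimePeriodic

end
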